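import Mathlib
import Summits.Ventures.PercRepro2.LeafAA0Reductions

/-!
# Row (LEAF-½) at a leaf among `v`, `b`, `o`: the row descends from the attachment vertex
(blind cell PercRepro2, p5 g28; `proofs/P5-OEDGE.md` §38)

`LeafAA0Reductions.lean` scales the (AA0) candidate at a leaf `v` (`crossAA_leaf`). Here the ROW
itself is scaled, for each of the three non-root marks hanging by a single edge `f` (weight `q`) at a
vertex `w` (`x ∉ {o, a₁, a₂, b, v} ∖ {x}`, `w` arbitrary):

* **`Rhalf_leaf_v`**: `R½(v) = q·R½(w) + 2(1 − q)·P(Q)·[anticov(oH, bL) + anticov(oL, bH)]`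
  (the margin `(P(Q) − m_v)` and the theorem terms `crossB`, `crossB′` are affine in the `v`-masses,
  the `(A)`-terms homogeneous) — so the row at the leaf follows from the row at the attachment vertex
  (**`LeafRow_leaf_v_of`**), by BHK06 1.4 for the two anticovariances;
* **`Rhalf_leaf_b`**: `R½(b) = q·R½(w)` (every `b`-mass is `q` times the `w`-mass; `R½` is linear in
  them) — **`LeafRow_leaf_b_of`**;
* **`Rhalf_leaf_o`**: `R½(o) = q·R½(w)` — **`LeafRow_leaf_o_of`**.

The masses of a leaf are `LeafAA0Reductions.prob_Q_conn_leaf` (the `C₂`-side) and its root mirror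
(`mass_leaf_L`, through `avoidAll_root_swap`); the identities are `ring` after the substitution.
With the one-far-mark transport (`LeafRowCutOneFar.lean`) these are the reductions of the row for a
mark alone behind a cut vertex. Nothing here claims the row in general.
-/

namespace Summit.Ventures.PercRepro2

open UnionCluster CovForm PendantRoot PendantO LeafStep LeafHalfCross

namespace LeafRowLeaves

variable {V : Type*} {E : Type*} [Fintype E] [DecidableEq E] [Fintype V] [DecidableEq V]
  {R : Type*} [Field R] [LinearOrder R] [IsStrictOrderedRing R]

variable (p : E → R) (ends : E → Sym2 V) {f : E} {x w : V}

/-! ## The masses of a leaf, in any order of intersection -/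

section Masses

omit [Fintype V] [DecidableEq V] [LinearOrder R] [IsStrictOrderedRing R] in
/-- The `C₂`-mass of a leaf `x` at `w`, for an event `Y = {x ∈ C₂} ∩ X` written in any order:
`P(Q, Y) = q · P(Q, Y′)` with `Y′ = {w ∈ C₂} ∩ X`. -/
lemma mass_leaf_H (hf : ends f = s(x, w)) (hleaf : ∀ e, x ∈ ends e → e = f) (hxw : x ≠ w)
    {a₁ a₂ : V} (h1 : x ≠ a₁) (h2 : x ≠ a₂) {X Y Y' : Set (Config E)} (hX : Free f X)
    (e : Y = connEvent ends a₂ x ∩ X) (e' : Y' = connEvent ends a₂ w ∩ X) :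
    prob p (avoidAll ends a₂ {a₁} ∩ Y) = p f * prob p (avoidAll ends a₂ {a₁} ∩ Y') := by
  rw [e, e']
  exact prob_Q_conn_leaf p ends hf hleaf hxw h1 h2 hX

omit [Fintype V] [DecidableEq V] [LinearOrder R] [IsStrictOrderedRing R] in
/-- The `C₁`-mass of a leaf `x` at `w` (the root mirror of `mass_leaf_H`). -/
lemma mass_leaf_L (hf : ends f = s(x, w)) (hleaf : ∀ e, x ∈ ends e → e = f) (hxw : x ≠ w)
    {a₁ a₂ : V} (h1 : x ≠ a₁) (h2 : x ≠ a₂) {X Y Y' : Set (Config E)} (hX : Free f X)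
    (e : Y = connEvent ends a₁ x ∩ X) (e' : Y' = connEvent ends a₁ w ∩ X) :
    prob p (avoidAll ends a₂ {a₁} ∩ Y) = p f * prob p (avoidAll ends a₂ {a₁} ∩ Y') := by
  rw [e, e', ← avoidAll_root_swap ends a₁ a₂]
  exact prob_Q_conn_leaf p ends hf hleaf hxw h2 h1 hX

end Masses

/-! ## The leaf `v` -/

section LeafV

omit [Fintype V] [DecidableEq V] [LinearOrder R] [IsStrictOrderedRing R] in
/-- `m_v = q · m_w` for a leaf `v` at `w`. -/
lemma mU_leaf (hf : ends f = s(x, w)) (hleaf : ∀ e, x ∈ ends e → e = f) (hxw : x ≠ w)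
    {a₁ a₂ : V} (h1 : x ≠ a₁) (h2 : x ≠ a₂) :
    mU p ends a₁ a₂ x = p f * mU p ends a₁ a₂ w := by
  unfold mU
  rw [mass_leaf_L p ends hf hleaf hxw h1 h2 (X := Set.univ) free_univ (Set.inter_univ _).symm
      (Set.inter_univ _).symm,
    mass_leaf_H p ends hf hleaf hxw h1 h2 (X := Set.univ) free_univ (Set.inter_univ _).symm
      (Set.inter_univ _).symm]
  ring

omit [Fintype V] [DecidableEq V] [LinearOrder R] [IsStrictOrderedRing R] in
/-- **`crossB` at a leaf `v`**: `crossB(v) = (1 − q)·P(Q)·anticov(oH, bL) + q·crossB(w)`. -/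
theorem crossB_leaf_v (hf : ends f = s(x, w)) (hleaf : ∀ e, x ∈ ends e → e = f) (hxw : x ≠ w)
    {o a₁ a₂ b : V} (h1 : x ≠ a₁) (h2 : x ≠ a₂) (ho : o ≠ x) (hb : b ≠ x) :
    crossB p ends o a₁ a₂ x b =
      (1 - p f) * prob p (avoidAll ends a₂ {a₁}) *
          anticov p ends a₁ a₂ (connEvent ends a₂ o) (connEvent ends a₁ b) +
        p f * crossB p ends o a₁ a₂ w b := by
  have cb : Free f (connEvent ends a₁ b) := free_connEvent hf hleaf hxw (Ne.symm h1) hb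
  have co : Free f (connEvent ends a₂ o) := free_connEvent hf hleaf hxw (Ne.symm h2) ho
  unfold crossB anticov
  rw [mass_leaf_H p ends hf hleaf hxw h1 h2 cb rfl rfl,
    mass_leaf_H p ends hf hleaf hxw h1 h2 (X := Set.univ) free_univ (Set.inter_univ _).symm
      (Set.inter_univ _).symm,
    mass_leaf_H p ends hf hleaf hxw h1 h2 co rfl rfl,
    mass_leaf_H p ends hf hleaf hxw h1 h2 (co.inter cb) rfl rfl]
  ring

omit [Fintype V] [DecidableEq V] [LinearOrder R] [IsStrictOrderedRing R] in
/-- **The mirror `crossB′` at a leaf `v`**: `crossB′(v) = (1 − q)·P(Q)·anticov(oL, bH) + q·crossB′(w)`. -/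
theorem crossB'_leaf_v (hf : ends f = s(x, w)) (hleaf : ∀ e, x ∈ ends e → e = f) (hxw : x ≠ w)
    {o a₁ a₂ b : V} (h1 : x ≠ a₁) (h2 : x ≠ a₂) (ho : o ≠ x) (hb : b ≠ x) :
    crossB p ends o a₂ a₁ x b =
      (1 - p f) * prob p (avoidAll ends a₂ {a₁}) *
          anticov p ends a₁ a₂ (connEvent ends a₁ o) (connEvent ends a₂ b) +
        p f * crossB p ends o a₂ a₁ w b := by
  have cb : Free f (connEvent ends a₂ b) := free_connEvent hf hleaf hxw (Ne.symm h2) hb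
  have co : Free f (connEvent ends a₁ o) := free_connEvent hf hleaf hxw (Ne.symm h1) ho
  unfold crossB anticov
  simp only [avoidAll_root_swap ends a₁ a₂]
  rw [mass_leaf_L p ends hf hleaf hxw h1 h2 cb rfl rfl,
    mass_leaf_L p ends hf hleaf hxw h1 h2 (X := Set.univ) free_univ (Set.inter_univ _).symm
      (Set.inter_univ _).symm,
    mass_leaf_L p ends hf hleaf hxw h1 h2 co rfl rfl,
    mass_leaf_L p ends hf hleaf hxw h1 h2 (co.inter cb) rfl rfl]
  ring

omit [Fintype V] in
/-- **`R½` at a leaf `v`**: `R½(v) = q·R½(w) + 2(1 − q)·P(Q)·[anticov(oH, bL) + anticov(oL, bH)]`. -/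
theorem Rhalf_leaf_v (hf : ends f = s(x, w)) (hleaf : ∀ e, x ∈ ends e → e = f) (hxw : x ≠ w)
    {o a₁ a₂ b : V} (h1 : x ≠ a₁) (h2 : x ≠ a₂) (ho : o ≠ x) (hb : b ≠ x) :
    Rhalf p ends o a₁ a₂ x b =
      p f * Rhalf p ends o a₁ a₂ w b +
        2 * (1 - p f) * prob p (avoidAll ends a₂ {a₁}) *
          (anticov p ends a₁ a₂ (connEvent ends a₂ o) (connEvent ends a₁ b) +
            anticov p ends a₁ a₂ (connEvent ends a₁ o) (connEvent ends a₂ b)) := by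
  rw [Rhalf_eq_four, Rhalf_eq_four, crossA_leaf p ends hf hleaf hxw h1 h2 ho hb,
    crossA_leaf p ends hf hleaf hxw h2 h1 ho hb, crossB_leaf_v p ends hf hleaf hxw h1 h2 ho hb,
    crossB'_leaf_v p ends hf hleaf hxw h1 h2 ho hb, mU_leaf p ends hf hleaf hxw h1 h2]
  ring

/-- **Row (LEAF-½) descends to a leaf `v`**: the row at the attachment vertex `w` gives the row at
the leaf `v` (BHK06 1.4 for the two anticovariances). -/
theorem LeafRow_leaf_v_of (hp : IsProbVec p) (hf : ends f = s(x, w))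
    (hleaf : ∀ e, x ∈ ends e → e = f) (hxw : x ≠ w) {o a₁ a₂ b : V} (h1 : x ≠ a₁) (h2 : x ≠ a₂)
    (ho : o ≠ x) (hb : b ≠ x) (hw : LeafRow p ends o a₁ a₂ w b) : LeafRow p ends o a₁ a₂ x b := by
  unfold LeafRow at hw ⊢
  rw [Rhalf_leaf_v p ends hf hleaf hxw h1 h2 ho hb]
  have hq0 := hp.nonneg f
  have hq1 := hp.le_one f
  have hA := anticov_nonneg_of_cross' p ends hp a₁ a₂ o b
  have hA' := anticov_nonneg_of_cross p ends hp a₁ a₂ o b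
  have hQ := prob_nonneg hp (avoidAll ends a₂ {a₁})
  have : 0 ≤ 2 * (1 - p f) * prob p (avoidAll ends a₂ {a₁}) *
      (anticov p ends a₁ a₂ (connEvent ends a₂ o) (connEvent ends a₁ b) +
        anticov p ends a₁ a₂ (connEvent ends a₁ o) (connEvent ends a₂ b)) :=
    mul_nonneg (mul_nonneg (mul_nonneg (by norm_num) (sub_nonneg.2 hq1)) hQ) (add_nonneg hA hA')
  have := mul_nonneg hq0 hw
  linarith

end LeafV

/-! ## The leaf `b` -/

section LeafB

omit [Fintype V] in
/-- **`R½` at a leaf `b`**: `R½(b) = q·R½(w)` — every `b`-mass is `q` times the `w`-mass and `R½` is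
linear in them. -/
theorem Rhalf_leaf_b (hf : ends f = s(x, w)) (hleaf : ∀ e, x ∈ ends e → e = f) (hxw : x ≠ w)
    {o a₁ a₂ v : V} (h1 : x ≠ a₁) (h2 : x ≠ a₂) (ho : o ≠ x) (hv : v ≠ x) :
    Rhalf p ends o a₁ a₂ v x = p f * Rhalf p ends o a₁ a₂ v w := by
  have coL : Free f (connEvent ends a₁ o) := free_connEvent hf hleaf hxw (Ne.symm h1) ho
  have coH : Free f (connEvent ends a₂ o) := free_connEvent hf hleaf hxw (Ne.symm h2) ho
  have cvL : Free f (connEvent ends a₁ v) := free_connEvent hf hleaf hxw (Ne.symm h1) hv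
  have cvH : Free f (connEvent ends a₂ v) := free_connEvent hf hleaf hxw (Ne.symm h2) hv
  -- the ten `b`-masses
  have m1 := mass_leaf_L p ends hf hleaf hxw h1 h2 (X := Set.univ) free_univ
    (Set.inter_univ _).symm (Set.inter_univ _).symm
  have m2 := mass_leaf_L p ends hf hleaf hxw h1 h2 coH
    (Y := connEvent ends a₂ o ∩ connEvent ends a₁ x) (Y' := connEvent ends a₂ o ∩ connEvent ends a₁ w)
    (Set.inter_comm _ _) (Set.inter_comm _ _)
  have m3 := mass_leaf_H p ends hf hleaf hxw h1 h2 (X := Set.univ) free_univ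
    (Set.inter_univ _).symm (Set.inter_univ _).symm
  have m4 := mass_leaf_H p ends hf hleaf hxw h1 h2 coL
    (Y := connEvent ends a₁ o ∩ connEvent ends a₂ x) (Y' := connEvent ends a₁ o ∩ connEvent ends a₂ w)
    (Set.inter_comm _ _) (Set.inter_comm _ _)
  have m5 := mass_leaf_L p ends hf hleaf hxw h1 h2 (cvH.inter coL)
    (Y := connEvent ends a₂ v ∩ (connEvent ends a₁ o ∩ connEvent ends a₁ x))
    (Y' := connEvent ends a₂ v ∩ (connEvent ends a₁ o ∩ connEvent ends a₁ w))
    (by ext ω; simp only [Set.mem_inter_iff]; tauto) (by ext ω; simp only [Set.mem_inter_iff]; tauto)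
  have m6 := mass_leaf_L p ends hf hleaf hxw h1 h2 cvH
    (Y := connEvent ends a₂ v ∩ connEvent ends a₁ x) (Y' := connEvent ends a₂ v ∩ connEvent ends a₁ w)
    (Set.inter_comm _ _) (Set.inter_comm _ _)
  have m7 := mass_leaf_H p ends hf hleaf hxw h1 h2 (cvL.inter coH)
    (Y := connEvent ends a₁ v ∩ (connEvent ends a₂ o ∩ connEvent ends a₂ x))
    (Y' := connEvent ends a₁ v ∩ (connEvent ends a₂ o ∩ connEvent ends a₂ w))
    (by ext ω; simp only [Set.mem_inter_iff]; tauto) (by ext ω; simp only [Set.mem_inter_iff]; tauto)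
  have m8 := mass_leaf_H p ends hf hleaf hxw h1 h2 cvL
    (Y := connEvent ends a₁ v ∩ connEvent ends a₂ x) (Y' := connEvent ends a₁ v ∩ connEvent ends a₂ w)
    (Set.inter_comm _ _) (Set.inter_comm _ _)
  have m9 := mass_leaf_L p ends hf hleaf hxw h1 h2 (cvH.inter coH)
    (Y := connEvent ends a₂ v ∩ (connEvent ends a₂ o ∩ connEvent ends a₁ x))
    (Y' := connEvent ends a₂ v ∩ (connEvent ends a₂ o ∩ connEvent ends a₁ w))
    (by ext ω; simp only [Set.mem_inter_iff]; tauto) (by ext ω; simp only [Set.mem_inter_iff]; tauto)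
  have m10 := mass_leaf_H p ends hf hleaf hxw h1 h2 (cvL.inter coL)
    (Y := connEvent ends a₁ v ∩ (connEvent ends a₁ o ∩ connEvent ends a₂ x))
    (Y' := connEvent ends a₁ v ∩ (connEvent ends a₁ o ∩ connEvent ends a₂ w))
    (by ext ω; simp only [Set.mem_inter_iff]; tauto) (by ext ω; simp only [Set.mem_inter_iff]; tauto)
  rw [Rhalf_eq_four, Rhalf_eq_four]
  unfold crossA crossB anticov
  simp only [avoidAll_root_swap ends a₁ a₂]
  rw [m1, m2, m3, m4, m5, m6, m7, m8, m9, m10]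
  ring

omit [Fintype V] in
/-- **Row (LEAF-½) descends to a leaf `b`.** -/
theorem LeafRow_leaf_b_of (hp : IsProbVec p) (hf : ends f = s(x, w))
    (hleaf : ∀ e, x ∈ ends e → e = f) (hxw : x ≠ w) {o a₁ a₂ v : V} (h1 : x ≠ a₁) (h2 : x ≠ a₂)
    (ho : o ≠ x) (hv : v ≠ x) (hw : LeafRow p ends o a₁ a₂ v w) : LeafRow p ends o a₁ a₂ v x := by
  unfold LeafRow at hw ⊢
  rw [Rhalf_leaf_b p ends hf hleaf hxw h1 h2 ho hv]
  exact mul_nonneg (hp.nonneg f) hw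

end LeafB

/-! ## The leaf `o` -/

section LeafO

omit [Fintype V] in
/-- **`R½` at a leaf `o`**: `R½(o) = q·R½(w)`. -/
theorem Rhalf_leaf_o (hf : ends f = s(x, w)) (hleaf : ∀ e, x ∈ ends e → e = f) (hxw : x ≠ w)
    {a₁ a₂ v b : V} (h1 : x ≠ a₁) (h2 : x ≠ a₂) (hb : b ≠ x) (hv : v ≠ x) :
    Rhalf p ends x a₁ a₂ v b = p f * Rhalf p ends w a₁ a₂ v b := by
  have cbL : Free f (connEvent ends a₁ b) := free_connEvent hf hleaf hxw (Ne.symm h1) hb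
  have cbH : Free f (connEvent ends a₂ b) := free_connEvent hf hleaf hxw (Ne.symm h2) hb
  have cvL : Free f (connEvent ends a₁ v) := free_connEvent hf hleaf hxw (Ne.symm h1) hv
  have cvH : Free f (connEvent ends a₂ v) := free_connEvent hf hleaf hxw (Ne.symm h2) hv
  -- the twelve `o`-masses
  have m1 := mass_leaf_H p ends hf hleaf hxw h1 h2 (X := Set.univ) free_univ
    (Set.inter_univ _).symm (Set.inter_univ _).symm
  have m2 := mass_leaf_H p ends hf hleaf hxw h1 h2 cbL rfl rfl
  have m3 := mass_leaf_L p ends hf hleaf hxw h1 h2 (X := Set.univ) free_univ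
    (Set.inter_univ _).symm (Set.inter_univ _).symm
  have m4 := mass_leaf_L p ends hf hleaf hxw h1 h2 cbH rfl rfl
  have m5 := mass_leaf_L p ends hf hleaf hxw h1 h2 (cvH.inter cbL)
    (Y := connEvent ends a₂ v ∩ (connEvent ends a₁ x ∩ connEvent ends a₁ b))
    (Y' := connEvent ends a₂ v ∩ (connEvent ends a₁ w ∩ connEvent ends a₁ b))
    (by ext ω; simp only [Set.mem_inter_iff]; tauto) (by ext ω; simp only [Set.mem_inter_iff]; tauto)
  have m6 := mass_leaf_L p ends hf hleaf hxw h1 h2 cvH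
    (Y := connEvent ends a₂ v ∩ connEvent ends a₁ x) (Y' := connEvent ends a₂ v ∩ connEvent ends a₁ w)
    (Set.inter_comm _ _) (Set.inter_comm _ _)
  have m7 := mass_leaf_H p ends hf hleaf hxw h1 h2 (cvL.inter cbH)
    (Y := connEvent ends a₁ v ∩ (connEvent ends a₂ x ∩ connEvent ends a₂ b))
    (Y' := connEvent ends a₁ v ∩ (connEvent ends a₂ w ∩ connEvent ends a₂ b))
    (by ext ω; simp only [Set.mem_inter_iff]; tauto) (by ext ω; simp only [Set.mem_inter_iff]; tauto)
  have m8 := mass_leaf_H p ends hf hleaf hxw h1 h2 cvL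
    (Y := connEvent ends a₁ v ∩ connEvent ends a₂ x) (Y' := connEvent ends a₁ v ∩ connEvent ends a₂ w)
    (Set.inter_comm _ _) (Set.inter_comm _ _)
  have m9 := mass_leaf_H p ends hf hleaf hxw h1 h2 cvH
    (Y := connEvent ends a₂ v ∩ connEvent ends a₂ x) (Y' := connEvent ends a₂ v ∩ connEvent ends a₂ w)
    (Set.inter_comm _ _) (Set.inter_comm _ _)
  have m10 := mass_leaf_H p ends hf hleaf hxw h1 h2 (cvH.inter cbL)
    (Y := connEvent ends a₂ v ∩ (connEvent ends a₂ x ∩ connEvent ends a₁ b))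
    (Y' := connEvent ends a₂ v ∩ (connEvent ends a₂ w ∩ connEvent ends a₁ b))
    (by ext ω; simp only [Set.mem_inter_iff]; tauto) (by ext ω; simp only [Set.mem_inter_iff]; tauto)
  have m11 := mass_leaf_L p ends hf hleaf hxw h1 h2 cvL
    (Y := connEvent ends a₁ v ∩ connEvent ends a₁ x) (Y' := connEvent ends a₁ v ∩ connEvent ends a₁ w)
    (Set.inter_comm _ _) (Set.inter_comm _ _)
  have m12 := mass_leaf_L p ends hf hleaf hxw h1 h2 (cvL.inter cbH)
    (Y := connEvent ends a₁ v ∩ (connEvent ends a₁ x ∩ connEvent ends a₂ b))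
    (Y' := connEvent ends a₁ v ∩ (connEvent ends a₁ w ∩ connEvent ends a₂ b))
    (by ext ω; simp only [Set.mem_inter_iff]; tauto) (by ext ω; simp only [Set.mem_inter_iff]; tauto)
  rw [Rhalf_eq_four, Rhalf_eq_four]
  unfold crossA crossB anticov
  simp only [avoidAll_root_swap ends a₁ a₂]
  rw [m1, m2, m3, m4, m5, m6, m7, m8, m9, m10, m11, m12]
  ring

omit [Fintype V] in
/-- **Row (LEAF-½) descends to a leaf `o`.** -/
theorem LeafRow_leaf_o_of (hp : IsProbVec p) (hf : ends f = s(x, w))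
    (hleaf : ∀ e, x ∈ ends e → e = f) (hxw : x ≠ w) {a₁ a₂ v b : V} (h1 : x ≠ a₁) (h2 : x ≠ a₂)
    (hb : b ≠ x) (hv : v ≠ x) (hw : LeafRow p ends w a₁ a₂ v b) : LeafRow p ends x a₁ a₂ v b := by
  unfold LeafRow at hw ⊢
  rw [Rhalf_leaf_o p ends hf hleaf hxw h1 h2 hb hv]
  exact mul_nonneg (hp.nonneg f) hw

end LeafO

end LeafRowLeaves

end Summit.Ventures.PercRepro2
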